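import Summits.ABC.IUTFork.Conditional.AbcOfSOrNumKContent
import Summits.ABC.IUTFork.Conditional.AbcOfCor312BadMix
import HarnessLib

/-!
# Crux `ThetaPartII` (stmt-ABC-19678), (U) line — the CONE-FREE TAIL (abc-iut-s2-p10 `ThetaPartII_of_cor312Bad_of_sqMix`, p460073) with BOTH inputs
# CUT TO THE CONTENT LOCUS OF [IUTchIV] Thm. 1.10's DISPLAY («θ-cut»): the crux and `ABC` from «number-level Cor. 3.12 at the Θ-data of every
# admissible `(P, l)` with content» + «Step (viii)'s squeeze at the content ∧ mixing points», AT THE CRUX LEVEL (`ThetaPartII` by name) — RESHAPE material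

Record-only PROOF file (D-0012) of the abc-iut cell (abc-iut-C-cert-1 gen 3, EVEN-revision writer; sequel to `Conditional/AbcOfSOrNumKContent.lean`,
p459802: the arithmetic of the content guard — `display_of_not_content`, `szpiroBad_of_content` — and the chain `thm110Legendre_of_squeezeIII_content`).
TAKES NO SIDE on [IUTchIII] Cor. 3.12 / [IUTchIV] Thm. 1.10 or on any author. PROOF-ONLY (no `def`, no new `Prop`; the binder texts are those of
abc-iut-s2-p10's p460073 with the Szpiro-bad antecedent REPLACED by the content guard; the mixing-locus text is abc-iut-s2-p1's, VERBATIM).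

The registered skeleton of the crux (RESHAPE-4, abc-iut-c312-8, capstone p455543) has two stubs demanded at the SZPIRO-BAD admissible points:
the number-level Corollary (`h312Bad`) and the hull regime above `B_III` (`haboveBad`); abc-iut-s2-p10's cone-free tail (p460073) replaces the
second by the Step (viii) squeeze on the mixing locus (`hSqMix`). HERE both inputs are demanded only ON THE CONTENT LOCUS
«`6·(1 + 20·d_mod/l)·(log-diff + log-cond) + 120·d*_mod·l < log q^{∤{2,l}}(λ)`» — off it [IUTchIV] Thm. 1.10's display holds for every `η > 0` by
its own additive constant, so the crux needs nothing there:

* `ThetaPartII_of_squeezeIII_content` — the crux BY NAME from the squeeze with `B_III(P,l)` demanded only on the content locus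
  (`thm110Legendre_of_squeezeIII_content` + abc-iut-S3's `Cor22.exists_partII_of_thm110Legendre` + the PROVED Galois-image input
  `Cor22.fullGaloisImage_holds`; θ-twin of abc-iut-S-d2's `ThetaPartIIDisplay.ThetaPartII_of_squeezeIII`);
* **`ThetaPartII_of_cor312C_of_sqMixC`** — the crux BY NAME from `h312C` «`Cor22.Cor312AtDatum P l` at every
  admissible `(P, l)` on the content locus» and `hSqMixC` «the Step (viii) squeeze at the admissible points on the content locus AND in the mixing
  locus» (off the mixing locus: abc-iut-s2-p10's `squeeze_of_cor312At_offMixingLocus`, i.e. abc-iut-s2-p1's hull estimate p455026 + abc-iut-S2's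
  squeeze). Each input is WEAKER-OR-EQUAL than p460073's (`szpiroBad_of_content`, C-R2). The `ABC`-level form of this tail is abc-iut-s2-p10's
  `ABC_of_cor312C_of_sqMixC` (`AbcOfStatementGenuineMixContent`, p461940, landed while this file was being written); HERE only the CRUX-level
  statements (`ThetaPartII` by name, the registered item stmt-ABC-19678) are added.

READING (numbers, not adjectives): with these stubs the crux asks for the disputed number-level inequality ONLY at admissible `(P, l)` with
`log q^{∤{2,l}}(λ) > 120·d*_mod·l ≥ 4.6·10⁸` nats (and Szpiro-bad, which the guard implies) — at no known or tabulable datum — and for nothing about our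
typed hull. Whether to re-register the skeleton on these stubs is the route owner's / planner's decision (abc-iut-plan); this file only makes the
composition kernel-visible. HONEST FRAMING: locates / conditionally verifies; nothing here asserts that abc is proved or refuted, or that [IUTchIII]
Cor. 3.12 / Thm. 3.11 or [IUTchIV] Thm. 1.10 holds or fails at any datum, or takes a side on any author (Mochizuki / Scholze–Stix / Joshi /
Dupuy–Hilado); `h312C` / `hSqMixC` are assumption labels, never asserted; a cut discharges nothing; typed ≠ proved; instantiated ≠ endorsed.
[claim: Mochizuki2012, status: disputed] [cite: Mochizuki2012, IUTchIII Cor. 3.12 p. 173–174; IUTchIV Thm. 1.10 p. 22–23 (display), Step (viii) p. 30,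
Cor. 2.2 (ii)–(iii) p. 43–47 (p. 46 l. 1)] [cite: DupuyHilado2025, §3.3, §3.6, §4.7]
-/

noncomputable section

open Set Function NumberField IsDedekindDomain

namespace Summit.ABC.IUTFork.Conditional

open Literature.IUT.LogVolume Literature.IUT.HodgeTheaters Literature.NumberTheory.NumberFields
open Literature.NumberTheory.DiophantineGeometry.GenEll Summit.ABC.ABC.Theorems
open scoped Classical

/-! ## §1 The crux from the squeeze on the content locus -/

/-- **The crux `ThetaPartII` BY NAME from the Step (viii) squeeze with `B_III(P,l)` demanded ONLY on the content locus** (θ-twin of abc-iut-S-d2's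
`ThetaPartIIDisplay.ThetaPartII_of_squeezeIII`: `thm110Legendre_of_squeezeIII_content` + `Cor22.exists_partII_of_thm110Legendre` +
`Cor22.fullGaloisImage_holds`). CONDITIONAL on `hsq`; the item stays open. [claim: Mochizuki2012, status: disputed]
[cite: Mochizuki2012, IUTchIV Thm. 1.10 Step (viii) p. 30; Cor. 2.2 (ii) p. 43–48] -/
theorem ThetaPartII_of_squeezeIII_content
    (hsq : ∀ P : NFPoint, P ∈ UP → ∀ l : ℕ, l.Prime → 5 ≤ l →
      Cor22.AdmitsCore P → Cor22.CondP2 P l → Cor22.CondP5 P l → Cor22.CondP6 P l →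
      6 * ((1 + 20 * (Cor22.dmod P : ℝ) / l) * (P.logDiff + Cor22.logCondAvoid P {2, l}))
          + 120 * (2 ^ 12 * 3 ^ 3 * 5 * (Cor22.dmod P : ℝ) * l) < Cor22.logQAvoid P {2, l} →
      (((l : ℝ) + 1) / 24 - 1 / (2 * l)) * Cor22.logQAvoid P {2, l} ≤
        ((l : ℝ) + 1) / 4 *
          ((1 + 12 * (Cor22.dmod P : ℝ) / l) * (P.logDiff + Cor22.logCondAvoid P {2, l})
            + 2 * Real.log l + 52
            + 20 / 3 * Real.log (((2 ^ 12 * 3 ^ 3 * 5 * Cor22.dmod P : ℕ) : ℝ) * (l : ℝ))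
              * (Nat.primeCounting (2 ^ 12 * 3 ^ 3 * 5 * Cor22.dmod P * l) : ℝ))
        + ThetaVolumeInput.archLogTheta l) :
    Summit.ABC.ABC.Theses.IUTThetaPilot.ThetaPartII := by
  unfold Summit.ABC.ABC.Theses.IUTThetaPilot.ThetaPartII
  exact Cor22.exists_partII_of_thm110Legendre (thm110Legendre_of_squeezeIII_content hsq) Cor22.fullGaloisImage_holds

/-! ## §2 The cone-free tail, θ-cut -/

/-- **The crux from the two θ-cut stubs** — `h312C` «number-level [IUTchIII] Cor. 3.12 at the Θ-data of every admissible `(P, l)` ON THE CONTENT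
LOCUS» and `hSqMixC` «[IUTchIV] Thm. 1.10 Step (viii)'s squeeze at the admissible points on the content locus and in abc-iut-s2-p1's mixing locus»
(θ-twin of abc-iut-s2-p10's `ThetaPartII_of_cor312Bad_of_sqMix`, p460073; off the mixing locus its `squeeze_of_cor312At_offMixingLocus`).
CONDITIONAL on both; nothing asserted; the crux item stays open. [claim: Mochizuki2012, status: disputed]
[cite: Mochizuki2012, IUTchIII Cor. 3.12 p. 174; IUTchIV Thm. 1.10 Step (viii) p. 30] -/
theorem ThetaPartII_of_cor312C_of_sqMixC
    (h312C : ∀ P : NFPoint, P ∈ UP → ∀ l : ℕ, l.Prime → 5 ≤ l →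
      Cor22.AdmitsCore P → Cor22.CondP2 P l → Cor22.CondP5 P l → Cor22.CondP6 P l →
      6 * ((1 + 20 * (Cor22.dmod P : ℝ) / l) * (P.logDiff + Cor22.logCondAvoid P {2, l}))
          + 120 * (2 ^ 12 * 3 ^ 3 * 5 * (Cor22.dmod P : ℝ) * l) < Cor22.logQAvoid P {2, l} →
        Cor22.Cor312AtDatum P l)
    -- [NUM-1.10, content ∧ mixing] [IUTchIV] Thm 1.10 Step (viii)'s squeeze at the admissible points ON THE CONTENT LOCUS and IN the mixing locus
    -- (the binder `hSqMixC` of `abc_of_SH_orNum_K_mix_content`, p460539, VERBATIM)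
    (hSqMixC : ∀ P : NFPoint, P ∈ UP → ∀ l : ℕ, l.Prime → 5 ≤ l →
      Cor22.AdmitsCore P → Cor22.CondP2 P l → Cor22.CondP5 P l → Cor22.CondP6 P l →
      6 * ((1 + 20 * (Cor22.dmod P : ℝ) / l) * (P.logDiff + Cor22.logCondAvoid P {2, l}))
          + 120 * (2 ^ 12 * 3 ^ 3 * 5 * (Cor22.dmod P : ℝ) * l) < Cor22.logQAvoid P {2, l} →
      ¬ (∃ M : Finset ℕ,
        (∀ p : ℕ, p.Prime →
          (¬ ∀ V W : HeightOneSpectrum (𝓞 ↥(IntermediateField.adjoin ℚ ({Cor22.jInv P.x} : Set P.F))),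
            V ∈ placesOver _ p → W ∈ placesOver _ p →
            (if ord _ V (Cor22.jMod P) < 0 ∧ ((2 : ℕ) : 𝓞 _) ∉ V.asIdeal ∧ ((l : ℕ) : 𝓞 _) ∉ V.asIdeal
              then ((-ord _ V (Cor22.jMod P) : ℤ) : ℝ) * logNorm _ V / (localDegree _ V : ℝ) else 0) =
            (if ord _ W (Cor22.jMod P) < 0 ∧ ((2 : ℕ) : 𝓞 _) ∉ W.asIdeal ∧ ((l : ℕ) : 𝓞 _) ∉ W.asIdeal
              then ((-ord _ W (Cor22.jMod P) : ℤ) : ℝ) * logNorm _ W / (localDegree _ W : ℝ) else 0)) → p ∈ M) ∧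
        ((l : ℝ) + 1) / 24 *
            ∑ p ∈ M, ∑ V : placesOver ↥(IntermediateField.adjoin ℚ ({Cor22.jInv P.x} : Set P.F)) p,
              (if ord _ V.1 (Cor22.jMod P) < 0 ∧ ((2 : ℕ) : 𝓞 _) ∉ V.1.asIdeal ∧ ((l : ℕ) : 𝓞 _) ∉ V.1.asIdeal then
                weight _ V.1 * (((-ord _ V.1 (Cor22.jMod P) : ℤ) : ℝ) * logNorm _ V.1 / (localDegree _ V.1 : ℝ))
               else 0) ≤
          ((l : ℝ) + 1) / 4 * (4 * ((Cor22.dmod P : ℝ) - 1) / l * (P.logDiff + Cor22.logCondAvoid P {2, l})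
            + 20 / 3 * Real.log (((2 ^ 12 * 3 ^ 3 * 5 * Cor22.dmod P : ℕ) : ℝ) * l)
              * max 0 (((Nat.primeCounting (2 ^ 12 * 3 ^ 3 * 5 * Cor22.dmod P * l) : ℝ)
                - (2 * (Cor22.dmod P : ℝ) * (P.logDiff + Cor22.logCondAvoid P {2, l}) + Real.log (2 * 3 * 5 * (l : ℝ)))
                  / Real.log 2)))) →
      (((l : ℝ) + 1) / 24 - 1 / (2 * l)) * Cor22.logQAvoid P {2, l} ≤
        ((l : ℝ) + 1) / 4 *
          ((1 + 12 * (Cor22.dmod P : ℝ) / l) * (P.logDiff + Cor22.logCondAvoid P {2, l})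
            + 2 * Real.log l + 52
            + 20 / 3 * Real.log (((2 ^ 12 * 3 ^ 3 * 5 * Cor22.dmod P : ℕ) : ℝ) * (l : ℝ))
              * (Nat.primeCounting (2 ^ 12 * 3 ^ 3 * 5 * Cor22.dmod P * l) : ℝ))
        + ThetaVolumeInput.archLogTheta l)
    : Summit.ABC.ABC.Theses.IUTThetaPilot.ThetaPartII := by
  refine ThetaPartII_of_squeezeIII_content fun P hP l hl h5 hc h2 h5' h6 hct => ?_
  -- the squeeze ON THE CONTENT LOCUS: OFF the mixing locus by abc-iut-s2-p10's §1 (p455026 + Cor. 3.12 at the point), ON it by `hSqMixC`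
  by_cases hOff : (∃ M : Finset ℕ,
      (∀ p : ℕ, p.Prime →
        (¬ ∀ V W : HeightOneSpectrum (𝓞 ↥(IntermediateField.adjoin ℚ ({Cor22.jInv P.x} : Set P.F))),
          V ∈ placesOver _ p → W ∈ placesOver _ p →
          (if ord _ V (Cor22.jMod P) < 0 ∧ ((2 : ℕ) : 𝓞 _) ∉ V.asIdeal ∧ ((l : ℕ) : 𝓞 _) ∉ V.asIdeal
            then ((-ord _ V (Cor22.jMod P) : ℤ) : ℝ) * logNorm _ V / (localDegree _ V : ℝ) else 0) =
          (if ord _ W (Cor22.jMod P) < 0 ∧ ((2 : ℕ) : 𝓞 _) ∉ W.asIdeal ∧ ((l : ℕ) : 𝓞 _) ∉ W.asIdeal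
            then ((-ord _ W (Cor22.jMod P) : ℤ) : ℝ) * logNorm _ W / (localDegree _ W : ℝ) else 0)) → p ∈ M) ∧
      ((l : ℝ) + 1) / 24 *
          ∑ p ∈ M, ∑ V : placesOver ↥(IntermediateField.adjoin ℚ ({Cor22.jInv P.x} : Set P.F)) p,
            (if ord _ V.1 (Cor22.jMod P) < 0 ∧ ((2 : ℕ) : 𝓞 _) ∉ V.1.asIdeal ∧ ((l : ℕ) : 𝓞 _) ∉ V.1.asIdeal then
              weight _ V.1 * (((-ord _ V.1 (Cor22.jMod P) : ℤ) : ℝ) * logNorm _ V.1 / (localDegree _ V.1 : ℝ))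
             else 0) ≤
        ((l : ℝ) + 1) / 4 * (4 * ((Cor22.dmod P : ℝ) - 1) / l * (P.logDiff + Cor22.logCondAvoid P {2, l})
          + 20 / 3 * Real.log (((2 ^ 12 * 3 ^ 3 * 5 * Cor22.dmod P : ℕ) : ℝ) * l)
            * max 0 (((Nat.primeCounting (2 ^ 12 * 3 ^ 3 * 5 * Cor22.dmod P * l) : ℝ)
              - (2 * (Cor22.dmod P : ℝ) * (P.logDiff + Cor22.logCondAvoid P {2, l}) + Real.log (2 * 3 * 5 * (l : ℝ)))
                / Real.log 2))))
  · exact squeeze_of_cor312At_offMixingLocus hP hl h5 hc h2 h5' h6 (h312C P hP l hl h5 hc h2 h5' h6 hct) hOff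
  · exact hSqMixC P hP l hl h5 hc h2 h5' h6 hct hOff

end Summit.ABC.IUTFork.Conditional

end
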